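import Mathlib
import Literature.NumberTheory.Automorphic.MatrixOrderRatLattice
import HarnessLib

/-!
# Conjugates of `M₂(ℤ)` inside `M₂(ℚ)`: unimodular and scalar conjugation, and the standard
# Eichler order `M₂(ℤ) ∩ δ_q M₂(ℤ) δ_q⁻¹ = (ℤ ℤ; qℤ ℤ)`, `δ_q = diag(1, q)`, of index `q`

Topic `NumberTheory/Automorphic`; theorems only (no definition, no named fact, no instance).
Elementary facts about the order `M₂(ℤ) ⊆ M₂(ℚ)` (tree `matrixOrder ℤ ℚ`, `JordanZassenhaus`)
and its conjugates `u M₂(ℤ) u⁻¹ = (matrixOrder ℤ ℚ).map (unitsConj u)` (tree `unitsConj`,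
`EichlerOrderLocalGlobal`), for the description of the Eichler orders of `M₂(ℚ)` (next file
`EichlerOrdersMatrixRat`; Vignéras, LNM 800, Ch. II §2: `O_N = (R R; NR R) = M(2,R) ∩ δ M(2,R) δ⁻¹`,
"l'ordre d'Eichler canonique de niveau `N`"):

* `exists_units_coe_eq_map_intCast` — integer matrices of unit determinant are units
  `γ ∈ GL₂(ℚ)` with `γ, γ⁻¹ ∈ M₂(ℤ)`; `map_unitsConj_matrixOrder_eq_of_mem` — for such `γ`,
  `γ M₂(ℤ) γ⁻¹ = M₂(ℤ)`;
* `map_unitsConj_eq_of_coe_eq_smul` — conjugation by `c u` equals conjugation by `u`;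
* `exists_units_coe_eq_diagonal`, `mem_inf_map_unitsConj_diagonal_iff` — for `q ≥ 1` and
  `δ = diag(1, q)`: `z ∈ M₂(ℤ) ∩ δ M₂(ℤ) δ⁻¹ ↔ z` is integral and `q ∣ z₁₀`;
* `relIndex_inf_map_unitsConj_diagonal` — `[M₂(ℤ) : M₂(ℤ) ∩ δ M₂(ℤ) δ⁻¹] = q`
  (via `z ↦ z₁₀ mod q`).

## References

* M.-F. Vignéras, *Arithmétique des algèbres de quaternions*, LNM 800 (1980), Ch. II §2
  (ordres d'Eichler de `M(2,K)`) [VignerasLNM800].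
-/

noncomputable section

open Matrix

namespace Literature.NumberTheory.Automorphic

/-! ### 1. Integral and unimodular matrices -/

/-- The entrywise image of an integer matrix lies in `M₂(ℤ) ⊆ M₂(ℚ)`. [folklore] -/
theorem map_intCast_mem_matrixOrder (A : Matrix (Fin 2) (Fin 2) ℤ) :
    A.map (Int.cast : ℤ → ℚ) ∈ (matrixOrder ℤ ℚ : Submodule ℤ (Matrix (Fin 2) (Fin 2) ℚ)) :=
  fun i j => ⟨A i j, by simp⟩

/-- A matrix of `M₂(ℤ) ⊆ M₂(ℚ)` is the image of an integer matrix. [folklore] -/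
theorem exists_eq_map_intCast_of_mem_matrixOrder {z : Matrix (Fin 2) (Fin 2) ℚ}
    (hz : z ∈ (matrixOrder ℤ ℚ : Submodule ℤ (Matrix (Fin 2) (Fin 2) ℚ))) :
    ∃ A : Matrix (Fin 2) (Fin 2) ℤ, z = A.map (Int.cast : ℤ → ℚ) := by
  choose n hn using fun i j => mem_matrixOrder_iff.mp hz i j
  refine ⟨Matrix.of fun i j => n i j, ?_⟩
  ext i j
  rw [map_apply, of_apply, ← hn i j, eq_intCast]

/-- Integrality of entries: `z ∈ M₂(ℤ)` iff every entry is an integer. [folklore] -/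
theorem mem_matrixOrder_iff_exists_intCast {z : Matrix (Fin 2) (Fin 2) ℚ} :
    z ∈ (matrixOrder ℤ ℚ : Submodule ℤ (Matrix (Fin 2) (Fin 2) ℚ)) ↔ ∀ i j, ∃ n : ℤ, z i j = n := by
  rw [mem_matrixOrder_iff]
  refine forall_congr' fun i => forall_congr' fun j => ⟨?_, ?_⟩
  · rintro ⟨n, hn⟩; exact ⟨n, by rw [← hn, eq_intCast]⟩
  · rintro ⟨n, hn⟩; exact ⟨n, by rw [hn, eq_intCast]⟩

/-- **Integer matrices of unit determinant are units of `M₂(ℚ)` with integral inverse**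
(`GL₂(ℤ) ⊆ GL₂(ℚ)`): for `A ∈ M₂(ℤ)` with `det A = ±1` there is `γ ∈ GL₂(ℚ)`, `γ = A`
entrywise, with `γ` and `γ⁻¹` in `M₂(ℤ)`. [folklore] -/
theorem exists_units_coe_eq_map_intCast (A : Matrix (Fin 2) (Fin 2) ℤ) (hA : IsUnit A.det) :
    ∃ γ : (Matrix (Fin 2) (Fin 2) ℚ)ˣ, (γ : Matrix (Fin 2) (Fin 2) ℚ) = A.map (Int.cast : ℤ → ℚ) ∧
      (γ : Matrix (Fin 2) (Fin 2) ℚ) ∈ (matrixOrder ℤ ℚ : Submodule ℤ (Matrix (Fin 2) (Fin 2) ℚ)) ∧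
      ((γ⁻¹ : (Matrix (Fin 2) (Fin 2) ℚ)ˣ) : Matrix (Fin 2) (Fin 2) ℚ) ∈
        (matrixOrder ℤ ℚ : Submodule ℤ (Matrix (Fin 2) (Fin 2) ℚ)) := by
  have hAu : IsUnit A := (Matrix.isUnit_iff_isUnit_det A).mpr hA
  let f : Matrix (Fin 2) (Fin 2) ℤ →* Matrix (Fin 2) (Fin 2) ℚ :=
    ((Int.castRingHom ℚ).mapMatrix : Matrix (Fin 2) (Fin 2) ℤ →+* Matrix (Fin 2) (Fin 2) ℚ).toMonoidHom
  have hf : ∀ X : Matrix (Fin 2) (Fin 2) ℤ, f X = X.map (Int.cast : ℤ → ℚ) := fun X => rfl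
  refine ⟨Units.map f hAu.unit, ?_, ?_, ?_⟩
  · rw [Units.coe_map, hAu.unit_spec, hf]
  · rw [Units.coe_map, hAu.unit_spec, hf]
    exact map_intCast_mem_matrixOrder A
  · rw [Units.coe_map_inv, hf]
    exact map_intCast_mem_matrixOrder _

/-- **`GL₂(ℤ)` normalises `M₂(ℤ)`**: if `γ` and `γ⁻¹` lie in `M₂(ℤ)` then
`γ M₂(ℤ) γ⁻¹ = M₂(ℤ)`. [folklore] -/
theorem map_unitsConj_matrixOrder_eq_of_mem (γ : (Matrix (Fin 2) (Fin 2) ℚ)ˣ)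
    (hγ : (γ : Matrix (Fin 2) (Fin 2) ℚ) ∈ (matrixOrder ℤ ℚ : Submodule ℤ (Matrix (Fin 2) (Fin 2) ℚ)))
    (hγ' : ((γ⁻¹ : (Matrix (Fin 2) (Fin 2) ℚ)ˣ) : Matrix (Fin 2) (Fin 2) ℚ) ∈
      (matrixOrder ℤ ℚ : Submodule ℤ (Matrix (Fin 2) (Fin 2) ℚ))) :
    (matrixOrder ℤ ℚ : Submodule ℤ (Matrix (Fin 2) (Fin 2) ℚ)).map
        (unitsConj γ : Matrix (Fin 2) (Fin 2) ℚ →ₗ[ℤ] Matrix (Fin 2) (Fin 2) ℚ) =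
      matrixOrder ℤ ℚ := by
  set g : Matrix (Fin 2) (Fin 2) ℚ := (γ : Matrix (Fin 2) (Fin 2) ℚ) with hg
  set g' : Matrix (Fin 2) (Fin 2) ℚ := ((γ⁻¹ : (Matrix (Fin 2) (Fin 2) ℚ)ˣ) : Matrix (Fin 2) (Fin 2) ℚ)
    with hg'
  have hgg' : g * g' = 1 := by rw [hg, hg', Units.mul_inv]
  ext z
  rw [mem_map_unitsConj_iff]
  constructor
  · intro h
    have e : z = g * (g' * z * g) * g' := by
      rw [show g * (g' * z * g) * g' = (g * g') * z * (g * g') by simp only [mul_assoc], hgg',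
        one_mul, mul_one]
    rw [e]
    exact mul_mem_matrixOrder (mul_mem_matrixOrder hγ h) hγ'
  · intro h
    exact mul_mem_matrixOrder (mul_mem_matrixOrder hγ' h) hγ

/-! ### 2. Scalar conjugation -/

/-- Conjugation by `u = c • v` is conjugation by `v` (scalars are central). [folklore] -/
theorem map_unitsConj_eq_of_coe_eq_smul {u v : (Matrix (Fin 2) (Fin 2) ℚ)ˣ} {c : ℚ}
    (h : (u : Matrix (Fin 2) (Fin 2) ℚ) = c • (v : Matrix (Fin 2) (Fin 2) ℚ))
    (L : Submodule ℤ (Matrix (Fin 2) (Fin 2) ℚ)) :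
    L.map (unitsConj u : Matrix (Fin 2) (Fin 2) ℚ →ₗ[ℤ] Matrix (Fin 2) (Fin 2) ℚ) =
      L.map (unitsConj v : Matrix (Fin 2) (Fin 2) ℚ →ₗ[ℤ] Matrix (Fin 2) (Fin 2) ℚ) := by
  have hc : c ≠ 0 := by
    rintro rfl
    rw [zero_smul] at h
    exact u.ne_zero h
  have hinv : ((u⁻¹ : (Matrix (Fin 2) (Fin 2) ℚ)ˣ) : Matrix (Fin 2) (Fin 2) ℚ) =
      c⁻¹ • ((v⁻¹ : (Matrix (Fin 2) (Fin 2) ℚ)ˣ) : Matrix (Fin 2) (Fin 2) ℚ) := by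
    refine Units.inv_eq_of_mul_eq_one_left ?_
    rw [h, smul_mul_smul_comm, inv_mul_cancel₀ hc, one_smul, Units.inv_mul]
  have key : ∀ z : Matrix (Fin 2) (Fin 2) ℚ,
      ((u⁻¹ : (Matrix (Fin 2) (Fin 2) ℚ)ˣ) : Matrix (Fin 2) (Fin 2) ℚ) * z * (u : Matrix (Fin 2) (Fin 2) ℚ) =
        ((v⁻¹ : (Matrix (Fin 2) (Fin 2) ℚ)ˣ) : Matrix (Fin 2) (Fin 2) ℚ) * z *
          (v : Matrix (Fin 2) (Fin 2) ℚ) := by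
    intro z
    rw [hinv, h, smul_mul_assoc, smul_mul_assoc, mul_smul_comm, smul_smul, inv_mul_cancel₀ hc,
      one_smul]
  ext z
  rw [mem_map_unitsConj_iff, mem_map_unitsConj_iff, key]

/-! ### 3. The standard Eichler order `M₂(ℤ) ∩ δ M₂(ℤ) δ⁻¹`, `δ = diag(1, q)` -/

/-- `diag(1, q)` as a unit of `M₂(ℚ)` (`q ≠ 0`), with inverse `diag(1, q⁻¹)`. [folklore] -/
theorem exists_units_coe_eq_diagonal {q : ℚ} (hq : q ≠ 0) :
    ∃ δ : (Matrix (Fin 2) (Fin 2) ℚ)ˣ, (δ : Matrix (Fin 2) (Fin 2) ℚ) = diagonal ![1, q] ∧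
      ((δ⁻¹ : (Matrix (Fin 2) (Fin 2) ℚ)ˣ) : Matrix (Fin 2) (Fin 2) ℚ) = diagonal ![1, q⁻¹] := by
  refine ⟨⟨diagonal ![1, q], diagonal ![1, q⁻¹], ?_, ?_⟩, rfl, rfl⟩
  · rw [diagonal_mul_diagonal]
    ext i j; fin_cases i <;> fin_cases j <;> simp [diagonal, hq]
  · rw [diagonal_mul_diagonal]
    ext i j; fin_cases i <;> fin_cases j <;> simp [diagonal, hq]

/-- The inverse of a unit `δ = diag(1, q)` is `diag(1, q⁻¹)`. [folklore] -/
theorem units_inv_coe_of_coe_eq_diagonal {q : ℚ} (hq : q ≠ 0) {δ : (Matrix (Fin 2) (Fin 2) ℚ)ˣ}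
    (hδ : (δ : Matrix (Fin 2) (Fin 2) ℚ) = diagonal ![1, q]) :
    ((δ⁻¹ : (Matrix (Fin 2) (Fin 2) ℚ)ˣ) : Matrix (Fin 2) (Fin 2) ℚ) = diagonal ![1, q⁻¹] := by
  refine Units.inv_eq_of_mul_eq_one_left ?_
  rw [hδ, diagonal_mul_diagonal]
  ext i j; fin_cases i <;> fin_cases j <;> simp [diagonal, hq]

/-- Entries of `δ⁻¹ z δ`, `δ = diag(1, q)`: `(z₀₀, q z₀₁; q⁻¹ z₁₀, z₁₁)`. [folklore] -/
theorem diagonal_inv_mul_mul_diagonal_apply {q : ℚ} (z : Matrix (Fin 2) (Fin 2) ℚ) (i j : Fin 2) :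
    (diagonal ![1, q⁻¹] * z * diagonal ![1, q]) i j = ![1, q⁻¹] i * z i j * ![1, q] j := by
  rw [mul_diagonal, diagonal_mul]

/-- **Membership in the standard Eichler order of level `q`**: for `q ≥ 1` and `δ = diag(1, q)`,
`z ∈ M₂(ℤ) ∩ δ M₂(ℤ) δ⁻¹` iff all entries of `z` are integers and `q ∣ z₁₀` — i.e.
`M₂(ℤ) ∩ δ M₂(ℤ) δ⁻¹ = (ℤ ℤ; qℤ ℤ)` (Vignéras II §2). [cite: VignerasLNM800, Ch. II §2 (ordre d'Eichler canonique de niveau N)] -/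
theorem mem_inf_map_unitsConj_diagonal_iff {q : ℕ} (hq : 0 < q) {δ : (Matrix (Fin 2) (Fin 2) ℚ)ˣ}
    (hδ : (δ : Matrix (Fin 2) (Fin 2) ℚ) = diagonal ![1, (q : ℚ)]) (z : Matrix (Fin 2) (Fin 2) ℚ) :
    z ∈ (matrixOrder ℤ ℚ : Submodule ℤ (Matrix (Fin 2) (Fin 2) ℚ)) ⊓
        (matrixOrder ℤ ℚ : Submodule ℤ (Matrix (Fin 2) (Fin 2) ℚ)).map
          (unitsConj δ : Matrix (Fin 2) (Fin 2) ℚ →ₗ[ℤ] Matrix (Fin 2) (Fin 2) ℚ) ↔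
      (∀ i j, ∃ n : ℤ, z i j = n) ∧ ∃ n : ℤ, z 1 0 = q * n := by
  have hq0 : (q : ℚ) ≠ 0 := by exact_mod_cast hq.ne'
  rw [Submodule.mem_inf, mem_map_unitsConj_iff, units_inv_coe_of_coe_eq_diagonal hq0 hδ, hδ,
    mem_matrixOrder_iff_exists_intCast, mem_matrixOrder_iff_exists_intCast]
  simp only [diagonal_inv_mul_mul_diagonal_apply]
  constructor
  · rintro ⟨hz, hz'⟩
    refine ⟨hz, ?_⟩
    obtain ⟨n, hn⟩ := hz' 1 0
    refine ⟨n, ?_⟩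
    have : (![1, (q : ℚ)⁻¹] : Fin 2 → ℚ) 1 * z 1 0 * (![1, (q : ℚ)] : Fin 2 → ℚ) 0 = (q : ℚ)⁻¹ * z 1 0 := by
      simp
    rw [this] at hn
    field_simp at hn
    linear_combination hn
  · rintro ⟨hz, n, hn⟩
    refine ⟨hz, fun i j => ?_⟩
    fin_cases i <;> fin_cases j
    · simpa using hz 0 0
    · obtain ⟨m, hm⟩ := hz 0 1
      exact ⟨m * q, by simp [hm]⟩
    · exact ⟨n, by simp [hn]; field_simp⟩
    · obtain ⟨m, hm⟩ := hz 1 1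
      exact ⟨m, by simp [hm]; field_simp⟩

/-- **The index of the standard Eichler order of level `q` in `M₂(ℤ)` is `q`**:
`[M₂(ℤ) : M₂(ℤ) ∩ δ M₂(ℤ) δ⁻¹] = q` for `δ = diag(1, q)`, `q ≥ 1` (the map `z ↦ z₁₀ mod q` is onto
`ℤ/qℤ` with this kernel). [cite: VignerasLNM800, Ch. II §2 (ordre d'Eichler canonique de niveau N)] -/
theorem relIndex_inf_map_unitsConj_diagonal {q : ℕ} (hq : 0 < q) {δ : (Matrix (Fin 2) (Fin 2) ℚ)ˣ}
    (hδ : (δ : Matrix (Fin 2) (Fin 2) ℚ) = diagonal ![1, (q : ℚ)]) :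
    ((matrixOrder ℤ ℚ : Submodule ℤ (Matrix (Fin 2) (Fin 2) ℚ)) ⊓
        (matrixOrder ℤ ℚ : Submodule ℤ (Matrix (Fin 2) (Fin 2) ℚ)).map
          (unitsConj δ : Matrix (Fin 2) (Fin 2) ℚ →ₗ[ℤ] Matrix (Fin 2) (Fin 2) ℚ)).toAddSubgroup.relIndex
      (matrixOrder ℤ ℚ : Submodule ℤ (Matrix (Fin 2) (Fin 2) ℚ)).toAddSubgroup = q := by
  classical
  haveI : NeZero q := ⟨hq.ne'⟩
  set MO : Submodule ℤ (Matrix (Fin 2) (Fin 2) ℚ) := matrixOrder ℤ ℚ with hMO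
  -- the integer `(1,0)`-entry of an element of `M₂(ℤ)`
  have hint : ∀ z : MO.toAddSubgroup, ∃ n : ℤ, (z : Matrix (Fin 2) (Fin 2) ℚ) 1 0 = n := fun z =>
    (mem_matrixOrder_iff_exists_intCast.mp z.2) 1 0
  choose ent hent using hint
  have hent_eq : ∀ (z : MO.toAddSubgroup) (n : ℤ), (z : Matrix (Fin 2) (Fin 2) ℚ) 1 0 = n → ent z = n :=
    fun z n hn => Int.cast_injective (α := ℚ) ((hent z).symm.trans hn)
  let f : MO.toAddSubgroup →+ ZMod q :=
    { toFun := fun z => ((ent z : ℤ) : ZMod q)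
      map_zero' := by
        have h0 : ent 0 = 0 := hent_eq 0 0 (by simp)
        rw [h0, Int.cast_zero]
      map_add' := fun z w => by
        have h : ent (z + w) = ent z + ent w := hent_eq (z + w) _ (by
          push_cast
          rw [← hent z, ← hent w]
          rfl)
        rw [h, Int.cast_add] }
  have hf : ∀ z : MO.toAddSubgroup, f z = ((ent z : ℤ) : ZMod q) := fun z => rfl
  -- kernel
  have hker : f.ker = ((MO ⊓ MO.map (unitsConj δ : Matrix (Fin 2) (Fin 2) ℚ →ₗ[ℤ]
      Matrix (Fin 2) (Fin 2) ℚ)).toAddSubgroup).addSubgroupOf MO.toAddSubgroup := by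
    ext z
    rw [AddMonoidHom.mem_ker, AddSubgroup.mem_addSubgroupOf, Submodule.mem_toAddSubgroup, hf,
      mem_inf_map_unitsConj_diagonal_iff hq hδ, ZMod.intCast_zmod_eq_zero_iff_dvd]
    constructor
    · rintro ⟨m, hm⟩
      refine ⟨mem_matrixOrder_iff_exists_intCast.mp z.2, m, ?_⟩
      rw [hent z, hm]; push_cast; ring
    · rintro ⟨-, m, hm⟩
      refine ⟨m, ?_⟩
      exact hent_eq z _ (by rw [hm]; push_cast; ring)
  -- surjectivity
  have hsurj : Function.Surjective f := by
    intro r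
    refine ⟨⟨!![0, 0; ((r.val : ℤ) : ℚ), 0], ?_⟩, ?_⟩
    · change _ ∈ MO
      rw [hMO, mem_matrixOrder_iff_exists_intCast]
      intro i j
      fin_cases i <;> fin_cases j
      · exact ⟨0, by simp⟩
      · exact ⟨0, by simp⟩
      · exact ⟨r.val, by simp⟩
      · exact ⟨0, by simp⟩
    · rw [hf, hent_eq _ (r.val : ℤ) (by simp)]
      simp
  rw [AddSubgroup.relIndex, ← hker, AddSubgroup.index_ker, AddMonoidHom.range_eq_top.mpr hsurj,
    AddSubgroup.card_top, Nat.card_zmod]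

end Literature.NumberTheory.Automorphic

end
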